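import Summits.AtomisticToContinuum.Crystallization.Theorems.FrustratedLawDichotomyCellF1Debit
import Summits.AtomisticToContinuum.Crystallization.Theorems.FrustratedLawDichotomyCellF1cNear

/-!
# FrustratedLawDichotomy · crux `AperiodicFrustratedLawGap` (stmt-AtomisticToContinuum-27623) — class-A K-file tower, layer 5c-c:
the F1 ROOT-DEBIT column over the COMPLETE template `MF1c` — it is #100's, VERBATIM (KFILE amendment E4, critic r1861; decomp-a2c hand-2 g48)

The (251) master reads the root-debit column on the list `ML = (ballL M zT ℓ_D 0).erase 0` only.  By #116 `ballL_Mc_root_eq` that list is the SAME Finset for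
`M = MF1c` as for `M = MF1` whenever `ℓ_D ≤ 330` (dial of record `ℓ_D = 23`), so #100's named column `debF1`, its label-wise certification `hdeb_F1` and its
integer fold `deb_sum_eq` transfer with no new table:
* `ballL_Mc_erase_subset_M_erase` — members of the complete root-centred punctured list are old non-root labels (`ℓ ≤ 330`);
* ★ `hdeb_F1c` — for every `F` of the strain cell and every `m ∈ (ballL MF1c zT ℓ 0).erase 0`, `τ²·secondNeg + energyRem ≤ debF1 m`;
* ★ `deb_sum_eq_c` — `Σ_{m ∈ (ballL MF1c zT ℓ 0).erase 0} debF1 m = (Σ_{ballF1' ℓ 0} debK)/2⁴⁰`, the same integer fold as #100's.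
Imports TREE #100 `…CellF1Debit` + #116 `…CellF1cNear`; 0 defs, 0 sorry.  Tags: [new: K-file layer]; nothing here closes an item.
-/

namespace Summit.AtomisticToContinuum.Crystallization.Theorems.FrustratedLawDichotomyCellF1cDebit

open scoped BigOperators
open Summit.AtomisticToContinuum.Crystallization.Theorems.FrustratedLawDichotomyCoherentFloorAlgebra (secondNeg energyRem)
open Summit.AtomisticToContinuum.Crystallization.Theorems.FrustratedLawDichotomyCellMetric (posL)
open Summit.AtomisticToContinuum.Crystallization.Theorems.FrustratedLawDichotomyCellClasses (ballL ballL_subset)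
open Summit.AtomisticToContinuum.Crystallization.Theorems.FrustratedLawDichotomyCellTriples (zT)
open Summit.AtomisticToContinuum.Crystallization.Theorems.FrustratedLawDichotomyCellF1Labels (MF1)
open Summit.AtomisticToContinuum.Crystallization.Theorems.FrustratedLawDichotomyCellF1cLabels (MF1c)
open Summit.AtomisticToContinuum.Crystallization.Theorems.FrustratedLawDichotomyCellF1Lists (ballF1')
open Summit.AtomisticToContinuum.Crystallization.Theorems.FrustratedLawDichotomyCellF1Pos (aF1)
open Summit.AtomisticToContinuum.Crystallization.Theorems.FrustratedLawDichotomyCellF1Debit (SZ debK debF1 hdeb_F1 deb_sum_eq)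
open Summit.AtomisticToContinuum.Crystallization.Theorems.FrustratedLawDichotomyCellF1cNear (ballL_Mc_root_eq ballL_Mc_root_erase_eq)

/-- members of the complete root-centred punctured near list are old non-root labels (`ℓ ≤ 330`). -/
theorem ballL_Mc_erase_subset_M_erase {ℓ : ℤ} (hℓ : ℓ ≤ 330) :
    (ballL MF1c zT ℓ (0 : ℤ × ℤ × ℤ)).erase 0 ⊆ MF1.erase 0 := by
  rw [ballL_Mc_root_erase_eq hℓ]
  exact Finset.erase_subset_erase 0 (ballL_subset MF1 zT ℓ 0)

/-- ★ THE DEBIT COLUMN OVER THE COMPLETE TEMPLATE, label-wise: for every `F` of the strain cell and every member of the complete debit list of radius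
`ℓ ≤ 330`, the root debit is below #100's reading `debF1 m`. -/
theorem hdeb_F1c {F : Matrix (Fin 3) (Fin 3) ℝ} (hG : ∀ i j, |(F.transpose * F) i j - (if i = j then 1 else 0)| ≤ 1 / 1024) {ℓ : ℤ} (hℓ : ℓ ≤ 330) :
    ∀ m ∈ (ballL MF1c zT ℓ (0 : ℤ × ℤ × ℤ)).erase 0,
      (1 / 1024 : ℝ) ^ 2 * secondNeg ‖posL F (aF1 m)‖ + energyRem ‖posL F (aF1 m)‖ (1 / 1024) ≤ debF1 m :=
  fun m hm => hdeb_F1 hG m (ballL_Mc_erase_subset_M_erase hℓ hm)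

/-- ★ the debit SUM over the complete debit list of radius `ℓ ≤ 330` is #100's integer fold. -/
theorem deb_sum_eq_c {ℓ : ℤ} (hℓ : ℓ ≤ 330) :
    ∑ m ∈ (ballL MF1c zT ℓ (0 : ℤ × ℤ × ℤ)).erase 0, debF1 m = ((((ballF1' ℓ 0).map debK).sum : ℤ) : ℝ) / SZ := by
  rw [ballL_Mc_root_erase_eq hℓ]; exact deb_sum_eq ℓ

end Summit.AtomisticToContinuum.Crystallization.Theorems.FrustratedLawDichotomyCellF1cDebit
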